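import Summits.Ventures.HodgeRepro2.T5RecordJointOutsideDiscriminant
import Summits.Ventures.HodgeRepro2.T5RationalPlace
import Summits.Ventures.HodgeRepro2.T5DiscriminantUnramified
import Summits.Ventures.HodgeRepro2.T5CyclotomicTwentyOneTable
import Summits.Ventures.HodgeRepro2.T5CyclotomicSevenHeckeCommutative
import Summits.Ventures.HodgeRepro2.T5CyclotomicSevenSplitPrime

/-!
# Joint consistency on the NON-cyclotomic sextic Galois CM field `F = ℚ(ζ₂₁)^{⟨σ₁₃⟩}`

Tier-5 support N3 / §G-N4.2 (seat p3, gen 87). The brief's case is the SEXTIC Galois CM field; the record's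
non-cyclotomic example is `F = ℚ(ζ₂₁)^{⟨σ₁₃⟩}` (file 286: cyclic of degree `6`, CM, not cyclotomic; files 289 / 290:
the census of its primes — `f(P/p) = ord(p · H_F)`, inert exactly at `p ≡ 2, 5, 8, 11, 17, 20 (mod 21)`). The joint
statement of file 356 needs `disc F ∉ v`; file 362 derives it from the unramifiedness of `F` at `p ∤ 21` (the
record's `T5CyclotomicUnramified.ramificationIdx_eq_one`). Hence:

* `natCast_mem_of_liesOver_of_liesOver` — `p ∈ v` for the place `v` of `F⁺` under `P ∣ p` (the record's
  `T5CyclotomicSevenSplitPrime.natCast_mem_under_of_liesOver`);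
* **`discr_fixedField_notMem`** — `disc F ∉ v` for every place `v` of `F⁺` above a prime `p ∤ 21`;
* **`joint_twentyOne_of_map_eq`** — for `p ∤ 21`, `P ∣ p` in `F`, `v` under `P`, `w` with `v 𝓞_F = w`: the
  lattice-model data for `diag(1, 1, −1)` at `v` over `vRat p` AND the unramified spectrum of the record's pair at
  `v` (Satake parameter `α · N(v)⁻²`);
* **`joint_twentyOne_two_mod`** — the place `w` supplied for every `p ≡ 2 (mod 21)` (file 290's
  `exists_map_eq_of_eq_two_mod`): `∃ w, ∃ hmap, …`;
* **`joint_twentyOne_of_mod`** (VERSION 2, appended) — the same for all six inert classes `p ≡ 2, 5, 8, 11, 17, 20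
  (mod 21)` (file 290's `exists_map_eq_iff_mod`): at EVERY place of `F⁺` above EVERY prime that stays prime in `F`.

With files 349 / 352 / 356 / 358 / 359: README §10.5 (ii)(d) is kernel on a non-cyclotomic sextic Galois CM field
at infinitely many places (file 290's Dirichlet class `p ≡ 2 (mod 21)`). §8(d): uses an L-value-free non-vanishing
device: NO.
-/

open Matrix NumberField NumberField.IsCMField IsDedekindDomain IsDedekindDomain.HeightOneSpectrum Module
  MulAction
open scoped TensorProduct Pointwise
open Summit.Ventures.HodgeRepro2.T5UnitaryGroupForm Summit.Ventures.HodgeRepro2.T5UnitaryHeckeAdjoint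
  Summit.Ventures.HodgeRepro2.T5HeckePermutationModule Summit.Ventures.HodgeRepro2.LevelPositivity
  Summit.Ventures.HodgeRepro2.T5LevelIdempotent Summit.Ventures.HodgeRepro2.T5StarOfInvolution
  Summit.Ventures.HodgeRepro2.T5FinitePlaceCM Summit.Ventures.HodgeRepro2.T5NonSplitPlaceUnitaryGroup
  Summit.Ventures.HodgeRepro2.T5RecordHyperspecial Summit.Ventures.HodgeRepro2.T5GlobalLatticeAlmostAll
  Summit.Ventures.HodgeRepro2.T5HermitianThreeElements Summit.Ventures.HodgeRepro2.T5GaloisCartanThree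
  Summit.Ventures.HodgeRepro2.T5InertDegreeGalois Summit.Ventures.HodgeRepro2.T5InertPlaceCompletion
  Summit.Ventures.HodgeRepro2.T5InertDegreeAdicCompletion Summit.Ventures.HodgeRepro2.T5InertSatakeTransform
  Summit.Ventures.HodgeRepro2.T5InertSatakeTransformCompletion Summit.Ventures.HodgeRepro2.T5InertUnipotentResidue
  Summit.Ventures.HodgeRepro2.T5InertSphericalSubquotient Summit.Ventures.HodgeRepro2.T5RecordSatakeCell
  Summit.Ventures.HodgeRepro2.T5SplitPlaceUnitaryGroup Summit.Ventures.HodgeRepro2.T5FinitePlaceNormIndex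
  Summit.Ventures.HodgeRepro2.T5HermitianLocalIsotropyN3 Summit.Ventures.HodgeRepro2.T5FinitePlaceSplitClassification
  Summit.Ventures.HodgeRepro2.T5InertDegreeCompletion Summit.Ventures.HodgeRepro2.T5InertPlaceCompletionCells
  Summit.Ventures.HodgeRepro2.T5RecordSatake Summit.Ventures.HodgeRepro2.T5CartanCellsDistinct
  Summit.Ventures.HodgeRepro2.T5RecordSatakeInert Summit.Ventures.HodgeRepro2.T5InertGlobalPrime
  Summit.Ventures.HodgeRepro2.T5CMFieldSquareDatum Summit.Ventures.HodgeRepro2.T5RecordSatakeDegree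
  Summit.Ventures.HodgeRepro2.T5RecordSatakeDegreeIntrinsic Summit.Ventures.HodgeRepro2.T5RecordSphericalSpectrum
  Summit.Ventures.HodgeRepro2.T5RecordSphericalSpectrumIntrinsic Summit.Ventures.HodgeRepro2.T5RecordSatakeToy
  Summit.Ventures.HodgeRepro2.T5RecordSphericalSpectrumDatumFree
  Summit.Ventures.HodgeRepro2.T5AdditiveConductor Summit.Ventures.HodgeRepro2.T5UnitaryGroupIsometry
  Summit.Ventures.HodgeRepro2.T5ConductorDualLattice Summit.Ventures.HodgeRepro2.T5ConductorDualLatticeSplit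
  Summit.Ventures.HodgeRepro2.T5SplitHermitianClass Summit.Ventures.HodgeRepro2.T5RecordLatticeModelOutsideDiscriminant
  Summit.Ventures.HodgeRepro2.T5RecordLatticeModelSeven Summit.Ventures.HodgeRepro2.T5RecordJointOutsideDiscriminant
  Summit.Ventures.HodgeRepro2.T5RationalPlace Summit.Ventures.HodgeRepro2.T5DiscriminantUnramified
  Summit.Ventures.HodgeRepro2.T5CyclotomicTwentyOneSextic Summit.Ventures.HodgeRepro2.T5CyclotomicTwentyOneCensus
  Summit.Ventures.HodgeRepro2.T5CyclotomicTwentyOneTable Summit.Ventures.HodgeRepro2.T5CyclotomicSevenHeckeCommutative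

namespace Summit.Ventures.HodgeRepro2.T5RecordJointTwentyOne

universe uV

variable (L : Type*) [Field L] [NumberField L] [IsCyclotomicExtension {21} ℚ L]
variable (p : ℕ) [hp : Fact p.Prime]

omit hp in
/-- `p ∈ v` for the place `v` of `F⁺` under a prime `P` of `F` lying over `(p)`. -/
theorem natCast_mem_of_liesOver_of_liesOver (P : Ideal (𝓞 (fixedField L))) [P.LiesOver (Ideal.span {(p : ℤ)})]
    (v : HeightOneSpectrum (𝓞 (maximalRealSubfield (fixedField L)))) [hPv : P.LiesOver v.asIdeal] :
    (p : 𝓞 (maximalRealSubfield (fixedField L))) ∈ v.asIdeal := by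
  have h := T5CyclotomicSevenSplitPrime.natCast_mem_under_of_liesOver (fixedField L) p P
  rwa [← hPv.over] at h

/-- **`disc F ∉ v` for every place `v` of `F⁺` above a prime `p ∤ 21`** (file 362 with the record's unramifiedness of
the cyclotomic subfield `F ⊆ ℚ(ζ₂₁)` at `p ∤ 21`). -/
theorem discr_fixedField_notMem (hp21 : ¬ p ∣ 21)
    (v : HeightOneSpectrum (𝓞 (maximalRealSubfield (fixedField L)))) [v.asIdeal.LiesOver (Ideal.span {(p : ℤ)})] :
    ((discr (fixedField L) : ℤ) : 𝓞 (maximalRealSubfield (fixedField L))) ∉ v.asIdeal :=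
  discr_notMem_of_forall_ramificationIdx_eq_one (fixedField L) p
    (fun w hw =>
      haveI := liesOver_int_of_mem p w hw
      T5CyclotomicUnramified.ramificationIdx_eq_one (m := 21) p L (fixedField L) hp21 w.asIdeal) v

/-- **JOINT CONSISTENCY ON `F = ℚ(ζ₂₁)^{⟨σ₁₃⟩}` AT EVERY PLACE THAT STAYS PRIME, ABOVE `p ∤ 21`** (file 356 at
`vp = vRat p`): for a prime `P` of `F` above `p`, the place `v` of `F⁺` under it and `w` with `v 𝓞_F = w`, the
lattice-model data for `diag(1, 1, −1)` AND the unramified spectrum of the record's pair. -/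
theorem joint_twentyOne_of_map_eq (hp21 : ¬ p ∣ 21) (P : Ideal (𝓞 (fixedField L))) [P.IsPrime]
    [P.LiesOver (Ideal.span {(p : ℤ)})] (v : HeightOneSpectrum (𝓞 (maximalRealSubfield (fixedField L))))
    [P.LiesOver v.asIdeal] (w : HeightOneSpectrum (𝓞 (fixedField L)))
    (hmap : Ideal.map (algebraMap (𝓞 (maximalRealSubfield (fixedField L))) (𝓞 (fixedField L))) v.asIdeal = w.asIdeal)
    (k : Type*) [Field k] [CharZero k] [IsAlgClosed k] :
    haveI := isCMField_fixedField L
    letI : v.asIdeal.LiesOver (vRat p).asIdeal := liesOver_vRat_of_mem p v (natCast_mem_of_liesOver_of_liesOver L p P v)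
    letI := liesOver_of_map_eq (fixedField L) v w hmap
    ((∃ ψ : AddChar ((vRat p).adicCompletion ℚ) Circle, Continuous ψ ∧ (∃ y, ψ y ≠ 1) ∧
      conductorExp ψ (Valued.v : Valuation ((vRat p).adicCompletion ℚ) (WithZero (Multiplicative ℤ))) = 0 ∧
      conductorExp (ψ.compAddMonoidHom
        (Algebra.trace ((vRat p).adicCompletion ℚ) (v.adicCompletion (maximalRealSubfield (fixedField L)))).toAddMonoidHom)
        (Valued.v : Valuation (v.adicCompletion (maximalRealSubfield (fixedField L))) (WithZero (Multiplicative ℤ))) = 0) ∧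
    ∀ (ψ : AddChar ((vRat p).adicCompletion ℚ) Circle), Continuous ψ → (∃ y, ψ y ≠ 1) →
      conductorExp ψ (Valued.v : Valuation ((vRat p).adicCompletion ℚ) (WithZero (Multiplicative ℤ))) = 0 →
      ∀ (w' : HeightOneSpectrum (𝓞 (fixedField L))) [w'.asIdeal.LiesOver v.asIdeal],
        v.asIdeal.ramificationIdx' w'.asIdeal = 1 ∧
        conductorExp (recordChar (fixedField L) (vRat p) v w' ψ)
          (Valued.v : Valuation (w'.adicCompletion (fixedField L)) (WithZero (Multiplicative ℤ))) = 0 ∧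
        (∀ x : w'.adicCompletion (fixedField L),
          (∀ y : w'.adicCompletion (fixedField L), Valued.v y ≤ 1 → recordChar (fixedField L) (vRat p) v w' ψ (x * y) = 1) ↔ Valued.v x ≤ 1) ∧
        (∀ [StarRing (w'.adicCompletion (fixedField L))],
          (∀ z : w'.adicCompletion (fixedField L), IsLocalization.IsInteger (w'.adicCompletionIntegers (fixedField L)) z →
            IsLocalization.IsInteger (w'.adicCompletionIntegers (fixedField L)) (star z)) →
          ∀ x : Fin 3 → w'.adicCompletion (fixedField L),
            (∀ y ∈ stdLattice (w'.adicCompletionIntegers (fixedField L)),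
              recordChar (fixedField L) (vRat p) v w' ψ
                (sesqForm (((algebraMap (𝓞 (fixedField L)) (fixedField L)).mapMatrix (Matrix.diagonal ![1, 1, -1])).map (algebraMap (fixedField L) (w'.adicCompletion (fixedField L)))) x y) = 1) ↔
              x ∈ stdLattice (w'.adicCompletionIntegers (fixedField L))) ∧
        (letI := swapStarRing (w'.adicCompletion (fixedField L))
          ∀ x : Fin 3 → w'.adicCompletion (fixedField L) × w'.adicCompletion (fixedField L),
            (∀ y : Fin 3 → w'.adicCompletion (fixedField L) × w'.adicCompletion (fixedField L),
              (∀ i, Valued.v (y i).1 ≤ 1 ∧ Valued.v (y i).2 ≤ 1) →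
              recordChar (fixedField L) (vRat p) v w' ψ
                  (sesqForm (pairMatrix (((algebraMap (𝓞 (fixedField L)) (fixedField L)).mapMatrix (Matrix.diagonal ![1, 1, -1])).map (algebraMap (fixedField L) (w'.adicCompletion (fixedField L))))
                    (((algebraMap (𝓞 (fixedField L)) (fixedField L)).mapMatrix (Matrix.diagonal ![1, 1, -1])).map (algebraMap (fixedField L) (w'.adicCompletion (fixedField L))))ᵀ) x y).1 *
                recordChar (fixedField L) (vRat p) v w' ψ
                  (sesqForm (pairMatrix (((algebraMap (𝓞 (fixedField L)) (fixedField L)).mapMatrix (Matrix.diagonal ![1, 1, -1])).map (algebraMap (fixedField L) (w'.adicCompletion (fixedField L))))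
                    (((algebraMap (𝓞 (fixedField L)) (fixedField L)).mapMatrix (Matrix.diagonal ![1, 1, -1])).map (algebraMap (fixedField L) (w'.adicCompletion (fixedField L))))ᵀ) x y).2 = 1) ↔
              ∀ i, Valued.v (x i).1 ≤ 1 ∧ Valued.v (x i).2 ≤ 1)) ∧
    (∃ (θ : maximalRealSubfield (fixedField L)) (y : (fixedField L)) (hθ : algebraMap (maximalRealSubfield (fixedField L)) (fixedField L) θ = y ^ 2)
      (hy : complexConj (fixedField L) y ≠ y) (r : ℕ) (l : Fin r → 𝓞 (fixedField L))
      (_hl : Submodule.span (𝓞 (maximalRealSubfield (fixedField L))) (Set.range l) = ⊤),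
      letI := tensorStarRing (fixedField L) v
      letI := starRingOfQuadratic (finrank_eq_two (fixedField L) v w hθ hy (not_isSquare_of_staysPrime (fixedField L) v w hθ hy hmap))
        (localConj v w hθ.symm (span_pair_eq_top (fixedField L) hy) (not_isSquare_of_staysPrime (fixedField L) v w hθ hy hmap) (complexConj (fixedField L)))
        (localConj_ne_one v w hθ.symm (span_pair_eq_top (fixedField L) hy) (not_isSquare_of_staysPrime (fixedField L) v w hθ hy hmap)
          (complexConj (fixedField L)) (complexConj_apply_eq_neg (fixedField L) hθ hy))
      haveI := isDiscreteValuationRing_integralClosure_adicCompletion v w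
      haveI := finite_residueField_integralClosure_adicCompletion v w
      haveI : IsFractionRing (integralClosure (v.adicCompletionIntegers (maximalRealSubfield (fixedField L))) (w.adicCompletion (fixedField L)))
        (w.adicCompletion (fixedField L)) :=
        integralClosure.isFractionRing_of_finite_extension (v.adicCompletion (maximalRealSubfield (fixedField L)))
          (w.adicCompletion (fixedField L))
      ∃ (u₀ : (v.adicCompletionIntegers (maximalRealSubfield (fixedField L)))ˣ)
        (Φ : ↥(formUnitaryGroup (J3 (algebraMap (v.adicCompletionIntegers (maximalRealSubfield (fixedField L)))
          (w.adicCompletion (fixedField L)) (u₀ : v.adicCompletionIntegers (maximalRealSubfield (fixedField L)))))) ≃*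
          ↥(formUnitaryGroup (tensorGram (fixedField L) v (gramToy (fixedField L)))))
        (ϖ' : integralClosure (v.adicCompletionIntegers (maximalRealSubfield (fixedField L))) (w.adicCompletion (fixedField L)))
        (hϖ' : Irreducible ϖ')
        (hs' : star (algebraMap (integralClosure (v.adicCompletionIntegers (maximalRealSubfield (fixedField L)))
          (w.adicCompletion (fixedField L))) (w.adicCompletion (fixedField L)) ϖ') =
            algebraMap (integralClosure (v.adicCompletionIntegers (maximalRealSubfield (fixedField L))) (w.adicCompletion (fixedField L)))
              (w.adicCompletion (fixedField L)) ϖ'),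
        (∀ g, g ∈ hyperspecialSubgroup
            (integralClosure (v.adicCompletionIntegers (maximalRealSubfield (fixedField L))) (w.adicCompletion (fixedField L)))
            (J3 (algebraMap (v.adicCompletionIntegers (maximalRealSubfield (fixedField L))) (w.adicCompletion (fixedField L))
              (u₀ : v.adicCompletionIntegers (maximalRealSubfield (fixedField L))))) ↔ Φ g ∈ recordHyperspecial (fixedField L) v l (gramToy (fixedField L))) ∧
        ∀ {V : Type uV} [AddCommGroup V] [Module k V]
          (ρ : Representation k (↥(formUnitaryGroup (tensorGram (fixedField L) v (gramToy (fixedField L))))) V) [ρ.IsIrreducible],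
          KFinite ρ (recordHyperspecial (fixedField L) v l (gramToy (fixedField L))) →
          ∀ [FiniteDimensional k (invariants ρ (recordHyperspecial (fixedField L) v l (gramToy (fixedField L))))],
          invariants ρ (recordHyperspecial (fixedField L) v l (gramToy (fixedField L))) ≠ ⊥ →
          ∃ α : k, α ≠ 0 ∧ Nonempty (ρ.Equiv (comp Φ.symm
            (inertSphericalQuot
              (hstar_of_star_eq (localConj v w hθ.symm (span_pair_eq_top (fixedField L) hy)
                (not_isSquare_of_staysPrime (fixedField L) v w hθ hy hmap) (complexConj (fixedField L)))
                (fun x => by rw [star_p8_eq_star (fixedField L) v w hθ hy (not_isSquare_of_staysPrime (fixedField L) v w hθ hy hmap)]; rfl))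
              (algebraMap (v.adicCompletionIntegers (maximalRealSubfield (fixedField L))) (w.adicCompletion (fixedField L))
                (u₀ : v.adicCompletionIntegers (maximalRealSubfield (fixedField L))))
              (star_algebraMap_of_star_eq (localConj v w hθ.symm (span_pair_eq_top (fixedField L) hy)
                (not_isSquare_of_staysPrime (fixedField L) v w hθ hy hmap) (complexConj (fixedField L)))
                (fun x => by rw [star_p8_eq_star (fixedField L) v w hθ hy (not_isSquare_of_staysPrime (fixedField L) v w hθ hy hmap)]; rfl)
                (u₀ : v.adicCompletionIntegers (maximalRealSubfield (fixedField L))))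
              (algebraMap_unit_ne_zero (F := v.adicCompletion (maximalRealSubfield (fixedField L))) u₀)
              (isInteger_algebraMap (u₀ : v.adicCompletionIntegers (maximalRealSubfield (fixedField L))))
              (isInteger_algebraMap_unit_inv u₀) hϖ' hs' k (α * ((Ideal.absNorm v.asIdeal : k) ^ 2)⁻¹))))) :=
  @joint_outside_discriminant_of_staysPrime (fixedField L) _ _ (isCMField_fixedField L) (vRat p) v
    (liesOver_vRat_of_mem p v (natCast_mem_of_liesOver_of_liesOver L p P v))
    (@discr_fixedField_notMem L _ _ _ p _ hp21 v (liesOver_int_of_mem p v (natCast_mem_of_liesOver_of_liesOver L p P v)))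
    w (liesOver_of_map_eq (fixedField L) v w hmap) hmap k _ _ _

/-- `p ∤ 21` for `p ≡ 2 (mod 21)` (the divisors of `21` are `3` and `7`). -/
theorem not_dvd_twentyOne_of_two_mod (h2 : p % 21 = 2) : ¬ p ∣ 21 := by
  intro hd
  rcases (Nat.Prime.dvd_mul hp.out).mp (show p ∣ 3 * 7 from hd) with h3 | h7
  · have := (Nat.prime_dvd_prime_iff_eq hp.out (by norm_num)).mp h3
    omega
  · have := (Nat.prime_dvd_prime_iff_eq hp.out (by norm_num)).mp h7
    omega

/-- **JOINT CONSISTENCY ON `F` AT EVERY PLACE ABOVE A PRIME `p ≡ 2 (mod 21)`** (`2, 23, 149, 191, …`; inert of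
degree `6`, `N(v) = p³`, file 290): the place `w` with `v 𝓞_F = w` is supplied. -/
theorem joint_twentyOne_two_mod (h2 : p % 21 = 2) (P : Ideal (𝓞 (fixedField L))) [P.IsPrime]
    [P.LiesOver (Ideal.span {(p : ℤ)})] (v : HeightOneSpectrum (𝓞 (maximalRealSubfield (fixedField L))))
    [P.LiesOver v.asIdeal] (k : Type*) [Field k] [CharZero k] [IsAlgClosed k] :
    haveI := isCMField_fixedField L
    letI : v.asIdeal.LiesOver (vRat p).asIdeal := liesOver_vRat_of_mem p v (natCast_mem_of_liesOver_of_liesOver L p P v)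
    ∃ (w : HeightOneSpectrum (𝓞 (fixedField L)))
      (hmap : Ideal.map (algebraMap (𝓞 (maximalRealSubfield (fixedField L))) (𝓞 (fixedField L))) v.asIdeal = w.asIdeal),
      letI := liesOver_of_map_eq (fixedField L) v w hmap
      ((∃ ψ : AddChar ((vRat p).adicCompletion ℚ) Circle, Continuous ψ ∧ (∃ y, ψ y ≠ 1) ∧
        conductorExp ψ (Valued.v : Valuation ((vRat p).adicCompletion ℚ) (WithZero (Multiplicative ℤ))) = 0 ∧
        conductorExp (ψ.compAddMonoidHom
          (Algebra.trace ((vRat p).adicCompletion ℚ) (v.adicCompletion (maximalRealSubfield (fixedField L)))).toAddMonoidHom)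
          (Valued.v : Valuation (v.adicCompletion (maximalRealSubfield (fixedField L))) (WithZero (Multiplicative ℤ))) = 0) ∧
      ∀ (ψ : AddChar ((vRat p).adicCompletion ℚ) Circle), Continuous ψ → (∃ y, ψ y ≠ 1) →
        conductorExp ψ (Valued.v : Valuation ((vRat p).adicCompletion ℚ) (WithZero (Multiplicative ℤ))) = 0 →
        ∀ (w' : HeightOneSpectrum (𝓞 (fixedField L))) [w'.asIdeal.LiesOver v.asIdeal],
          v.asIdeal.ramificationIdx' w'.asIdeal = 1 ∧
          conductorExp (recordChar (fixedField L) (vRat p) v w' ψ)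
            (Valued.v : Valuation (w'.adicCompletion (fixedField L)) (WithZero (Multiplicative ℤ))) = 0 ∧
          (∀ x : w'.adicCompletion (fixedField L),
            (∀ y : w'.adicCompletion (fixedField L), Valued.v y ≤ 1 → recordChar (fixedField L) (vRat p) v w' ψ (x * y) = 1) ↔ Valued.v x ≤ 1) ∧
          (∀ [StarRing (w'.adicCompletion (fixedField L))],
            (∀ z : w'.adicCompletion (fixedField L), IsLocalization.IsInteger (w'.adicCompletionIntegers (fixedField L)) z →
              IsLocalization.IsInteger (w'.adicCompletionIntegers (fixedField L)) (star z)) →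
            ∀ x : Fin 3 → w'.adicCompletion (fixedField L),
              (∀ y ∈ stdLattice (w'.adicCompletionIntegers (fixedField L)),
                recordChar (fixedField L) (vRat p) v w' ψ
                  (sesqForm (((algebraMap (𝓞 (fixedField L)) (fixedField L)).mapMatrix (Matrix.diagonal ![1, 1, -1])).map (algebraMap (fixedField L) (w'.adicCompletion (fixedField L)))) x y) = 1) ↔
                x ∈ stdLattice (w'.adicCompletionIntegers (fixedField L))) ∧
          (letI := swapStarRing (w'.adicCompletion (fixedField L))
            ∀ x : Fin 3 → w'.adicCompletion (fixedField L) × w'.adicCompletion (fixedField L),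
              (∀ y : Fin 3 → w'.adicCompletion (fixedField L) × w'.adicCompletion (fixedField L),
                (∀ i, Valued.v (y i).1 ≤ 1 ∧ Valued.v (y i).2 ≤ 1) →
                recordChar (fixedField L) (vRat p) v w' ψ
                    (sesqForm (pairMatrix (((algebraMap (𝓞 (fixedField L)) (fixedField L)).mapMatrix (Matrix.diagonal ![1, 1, -1])).map (algebraMap (fixedField L) (w'.adicCompletion (fixedField L))))
                      (((algebraMap (𝓞 (fixedField L)) (fixedField L)).mapMatrix (Matrix.diagonal ![1, 1, -1])).map (algebraMap (fixedField L) (w'.adicCompletion (fixedField L))))ᵀ) x y).1 *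
                  recordChar (fixedField L) (vRat p) v w' ψ
                    (sesqForm (pairMatrix (((algebraMap (𝓞 (fixedField L)) (fixedField L)).mapMatrix (Matrix.diagonal ![1, 1, -1])).map (algebraMap (fixedField L) (w'.adicCompletion (fixedField L))))
                      (((algebraMap (𝓞 (fixedField L)) (fixedField L)).mapMatrix (Matrix.diagonal ![1, 1, -1])).map (algebraMap (fixedField L) (w'.adicCompletion (fixedField L))))ᵀ) x y).2 = 1) ↔
                ∀ i, Valued.v (x i).1 ≤ 1 ∧ Valued.v (x i).2 ≤ 1)) ∧
      (∃ (θ : maximalRealSubfield (fixedField L)) (y : (fixedField L)) (hθ : algebraMap (maximalRealSubfield (fixedField L)) (fixedField L) θ = y ^ 2)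
        (hy : complexConj (fixedField L) y ≠ y) (r : ℕ) (l : Fin r → 𝓞 (fixedField L))
        (_hl : Submodule.span (𝓞 (maximalRealSubfield (fixedField L))) (Set.range l) = ⊤),
        letI := tensorStarRing (fixedField L) v
        letI := starRingOfQuadratic (finrank_eq_two (fixedField L) v w hθ hy (not_isSquare_of_staysPrime (fixedField L) v w hθ hy hmap))
          (localConj v w hθ.symm (span_pair_eq_top (fixedField L) hy) (not_isSquare_of_staysPrime (fixedField L) v w hθ hy hmap) (complexConj (fixedField L)))
          (localConj_ne_one v w hθ.symm (span_pair_eq_top (fixedField L) hy) (not_isSquare_of_staysPrime (fixedField L) v w hθ hy hmap)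
            (complexConj (fixedField L)) (complexConj_apply_eq_neg (fixedField L) hθ hy))
        haveI := isDiscreteValuationRing_integralClosure_adicCompletion v w
        haveI := finite_residueField_integralClosure_adicCompletion v w
        haveI : IsFractionRing (integralClosure (v.adicCompletionIntegers (maximalRealSubfield (fixedField L))) (w.adicCompletion (fixedField L)))
          (w.adicCompletion (fixedField L)) :=
          integralClosure.isFractionRing_of_finite_extension (v.adicCompletion (maximalRealSubfield (fixedField L)))
            (w.adicCompletion (fixedField L))
        ∃ (u₀ : (v.adicCompletionIntegers (maximalRealSubfield (fixedField L)))ˣ)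
          (Φ : ↥(formUnitaryGroup (J3 (algebraMap (v.adicCompletionIntegers (maximalRealSubfield (fixedField L)))
            (w.adicCompletion (fixedField L)) (u₀ : v.adicCompletionIntegers (maximalRealSubfield (fixedField L)))))) ≃*
            ↥(formUnitaryGroup (tensorGram (fixedField L) v (gramToy (fixedField L)))))
          (ϖ' : integralClosure (v.adicCompletionIntegers (maximalRealSubfield (fixedField L))) (w.adicCompletion (fixedField L)))
          (hϖ' : Irreducible ϖ')
          (hs' : star (algebraMap (integralClosure (v.adicCompletionIntegers (maximalRealSubfield (fixedField L)))
            (w.adicCompletion (fixedField L))) (w.adicCompletion (fixedField L)) ϖ') =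
              algebraMap (integralClosure (v.adicCompletionIntegers (maximalRealSubfield (fixedField L))) (w.adicCompletion (fixedField L)))
                (w.adicCompletion (fixedField L)) ϖ'),
          (∀ g, g ∈ hyperspecialSubgroup
              (integralClosure (v.adicCompletionIntegers (maximalRealSubfield (fixedField L))) (w.adicCompletion (fixedField L)))
              (J3 (algebraMap (v.adicCompletionIntegers (maximalRealSubfield (fixedField L))) (w.adicCompletion (fixedField L))
                (u₀ : v.adicCompletionIntegers (maximalRealSubfield (fixedField L))))) ↔ Φ g ∈ recordHyperspecial (fixedField L) v l (gramToy (fixedField L))) ∧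
          ∀ {V : Type uV} [AddCommGroup V] [Module k V]
            (ρ : Representation k (↥(formUnitaryGroup (tensorGram (fixedField L) v (gramToy (fixedField L))))) V) [ρ.IsIrreducible],
            KFinite ρ (recordHyperspecial (fixedField L) v l (gramToy (fixedField L))) →
            ∀ [FiniteDimensional k (invariants ρ (recordHyperspecial (fixedField L) v l (gramToy (fixedField L))))],
            invariants ρ (recordHyperspecial (fixedField L) v l (gramToy (fixedField L))) ≠ ⊥ →
            ∃ α : k, α ≠ 0 ∧ Nonempty (ρ.Equiv (comp Φ.symm
              (inertSphericalQuot
                (hstar_of_star_eq (localConj v w hθ.symm (span_pair_eq_top (fixedField L) hy)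
                  (not_isSquare_of_staysPrime (fixedField L) v w hθ hy hmap) (complexConj (fixedField L)))
                  (fun x => by rw [star_p8_eq_star (fixedField L) v w hθ hy (not_isSquare_of_staysPrime (fixedField L) v w hθ hy hmap)]; rfl))
                (algebraMap (v.adicCompletionIntegers (maximalRealSubfield (fixedField L))) (w.adicCompletion (fixedField L))
                  (u₀ : v.adicCompletionIntegers (maximalRealSubfield (fixedField L))))
                (star_algebraMap_of_star_eq (localConj v w hθ.symm (span_pair_eq_top (fixedField L) hy)
                  (not_isSquare_of_staysPrime (fixedField L) v w hθ hy hmap) (complexConj (fixedField L)))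
                  (fun x => by rw [star_p8_eq_star (fixedField L) v w hθ hy (not_isSquare_of_staysPrime (fixedField L) v w hθ hy hmap)]; rfl)
                  (u₀ : v.adicCompletionIntegers (maximalRealSubfield (fixedField L))))
                (algebraMap_unit_ne_zero (F := v.adicCompletion (maximalRealSubfield (fixedField L))) u₀)
                (isInteger_algebraMap (u₀ : v.adicCompletionIntegers (maximalRealSubfield (fixedField L))))
                (isInteger_algebraMap_unit_inv u₀) hϖ' hs' k (α * ((Ideal.absNorm v.asIdeal : k) ^ 2)⁻¹))))) :=
  (exists_map_eq_of_eq_two_mod L p h2 P v).2.elim fun w hmap =>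
    ⟨w, hmap, @joint_outside_discriminant_of_staysPrime (fixedField L) _ _ (isCMField_fixedField L) (vRat p) v
      (liesOver_vRat_of_mem p v (natCast_mem_of_liesOver_of_liesOver L p P v))
      (@discr_fixedField_notMem L _ _ _ p _ (not_dvd_twentyOne_of_two_mod p h2) v
        (liesOver_int_of_mem p v (natCast_mem_of_liesOver_of_liesOver L p P v)))
      w (liesOver_of_map_eq (fixedField L) v w hmap) hmap k _ _ _⟩

/-- **JOINT CONSISTENCY ON `F` AT EVERY PLACE ABOVE EVERY PRIME THAT STAYS PRIME IN `F`** — the six classes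
`p ≡ 2, 5, 8, 11, 17, 20 (mod 21)` (file 290's `exists_map_eq_iff_mod`): the place `w` with `v 𝓞_F = w` is supplied. -/
theorem joint_twentyOne_of_mod (hpm : p.Coprime 21) (hmod : p % 21 ∈ ({2, 5, 8, 11, 17, 20} : Finset ℕ)) (P : Ideal (𝓞 (fixedField L))) [P.IsPrime]
    [P.LiesOver (Ideal.span {(p : ℤ)})] (v : HeightOneSpectrum (𝓞 (maximalRealSubfield (fixedField L))))
    [P.LiesOver v.asIdeal] (k : Type*) [Field k] [CharZero k] [IsAlgClosed k] :
    haveI := isCMField_fixedField L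
    letI : v.asIdeal.LiesOver (vRat p).asIdeal := liesOver_vRat_of_mem p v (natCast_mem_of_liesOver_of_liesOver L p P v)
    ∃ (w : HeightOneSpectrum (𝓞 (fixedField L)))
      (hmap : Ideal.map (algebraMap (𝓞 (maximalRealSubfield (fixedField L))) (𝓞 (fixedField L))) v.asIdeal = w.asIdeal),
      letI := liesOver_of_map_eq (fixedField L) v w hmap
      ((∃ ψ : AddChar ((vRat p).adicCompletion ℚ) Circle, Continuous ψ ∧ (∃ y, ψ y ≠ 1) ∧
        conductorExp ψ (Valued.v : Valuation ((vRat p).adicCompletion ℚ) (WithZero (Multiplicative ℤ))) = 0 ∧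
        conductorExp (ψ.compAddMonoidHom
          (Algebra.trace ((vRat p).adicCompletion ℚ) (v.adicCompletion (maximalRealSubfield (fixedField L)))).toAddMonoidHom)
          (Valued.v : Valuation (v.adicCompletion (maximalRealSubfield (fixedField L))) (WithZero (Multiplicative ℤ))) = 0) ∧
      ∀ (ψ : AddChar ((vRat p).adicCompletion ℚ) Circle), Continuous ψ → (∃ y, ψ y ≠ 1) →
        conductorExp ψ (Valued.v : Valuation ((vRat p).adicCompletion ℚ) (WithZero (Multiplicative ℤ))) = 0 →
        ∀ (w' : HeightOneSpectrum (𝓞 (fixedField L))) [w'.asIdeal.LiesOver v.asIdeal],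
          v.asIdeal.ramificationIdx' w'.asIdeal = 1 ∧
          conductorExp (recordChar (fixedField L) (vRat p) v w' ψ)
            (Valued.v : Valuation (w'.adicCompletion (fixedField L)) (WithZero (Multiplicative ℤ))) = 0 ∧
          (∀ x : w'.adicCompletion (fixedField L),
            (∀ y : w'.adicCompletion (fixedField L), Valued.v y ≤ 1 → recordChar (fixedField L) (vRat p) v w' ψ (x * y) = 1) ↔ Valued.v x ≤ 1) ∧
          (∀ [StarRing (w'.adicCompletion (fixedField L))],
            (∀ z : w'.adicCompletion (fixedField L), IsLocalization.IsInteger (w'.adicCompletionIntegers (fixedField L)) z →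
              IsLocalization.IsInteger (w'.adicCompletionIntegers (fixedField L)) (star z)) →
            ∀ x : Fin 3 → w'.adicCompletion (fixedField L),
              (∀ y ∈ stdLattice (w'.adicCompletionIntegers (fixedField L)),
                recordChar (fixedField L) (vRat p) v w' ψ
                  (sesqForm (((algebraMap (𝓞 (fixedField L)) (fixedField L)).mapMatrix (Matrix.diagonal ![1, 1, -1])).map (algebraMap (fixedField L) (w'.adicCompletion (fixedField L)))) x y) = 1) ↔
                x ∈ stdLattice (w'.adicCompletionIntegers (fixedField L))) ∧
          (letI := swapStarRing (w'.adicCompletion (fixedField L))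
            ∀ x : Fin 3 → w'.adicCompletion (fixedField L) × w'.adicCompletion (fixedField L),
              (∀ y : Fin 3 → w'.adicCompletion (fixedField L) × w'.adicCompletion (fixedField L),
                (∀ i, Valued.v (y i).1 ≤ 1 ∧ Valued.v (y i).2 ≤ 1) →
                recordChar (fixedField L) (vRat p) v w' ψ
                    (sesqForm (pairMatrix (((algebraMap (𝓞 (fixedField L)) (fixedField L)).mapMatrix (Matrix.diagonal ![1, 1, -1])).map (algebraMap (fixedField L) (w'.adicCompletion (fixedField L))))
                      (((algebraMap (𝓞 (fixedField L)) (fixedField L)).mapMatrix (Matrix.diagonal ![1, 1, -1])).map (algebraMap (fixedField L) (w'.adicCompletion (fixedField L))))ᵀ) x y).1 *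
                  recordChar (fixedField L) (vRat p) v w' ψ
                    (sesqForm (pairMatrix (((algebraMap (𝓞 (fixedField L)) (fixedField L)).mapMatrix (Matrix.diagonal ![1, 1, -1])).map (algebraMap (fixedField L) (w'.adicCompletion (fixedField L))))
                      (((algebraMap (𝓞 (fixedField L)) (fixedField L)).mapMatrix (Matrix.diagonal ![1, 1, -1])).map (algebraMap (fixedField L) (w'.adicCompletion (fixedField L))))ᵀ) x y).2 = 1) ↔
                ∀ i, Valued.v (x i).1 ≤ 1 ∧ Valued.v (x i).2 ≤ 1)) ∧
      (∃ (θ : maximalRealSubfield (fixedField L)) (y : (fixedField L)) (hθ : algebraMap (maximalRealSubfield (fixedField L)) (fixedField L) θ = y ^ 2)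
        (hy : complexConj (fixedField L) y ≠ y) (r : ℕ) (l : Fin r → 𝓞 (fixedField L))
        (_hl : Submodule.span (𝓞 (maximalRealSubfield (fixedField L))) (Set.range l) = ⊤),
        letI := tensorStarRing (fixedField L) v
        letI := starRingOfQuadratic (finrank_eq_two (fixedField L) v w hθ hy (not_isSquare_of_staysPrime (fixedField L) v w hθ hy hmap))
          (localConj v w hθ.symm (span_pair_eq_top (fixedField L) hy) (not_isSquare_of_staysPrime (fixedField L) v w hθ hy hmap) (complexConj (fixedField L)))
          (localConj_ne_one v w hθ.symm (span_pair_eq_top (fixedField L) hy) (not_isSquare_of_staysPrime (fixedField L) v w hθ hy hmap)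
            (complexConj (fixedField L)) (complexConj_apply_eq_neg (fixedField L) hθ hy))
        haveI := isDiscreteValuationRing_integralClosure_adicCompletion v w
        haveI := finite_residueField_integralClosure_adicCompletion v w
        haveI : IsFractionRing (integralClosure (v.adicCompletionIntegers (maximalRealSubfield (fixedField L))) (w.adicCompletion (fixedField L)))
          (w.adicCompletion (fixedField L)) :=
          integralClosure.isFractionRing_of_finite_extension (v.adicCompletion (maximalRealSubfield (fixedField L)))
            (w.adicCompletion (fixedField L))
        ∃ (u₀ : (v.adicCompletionIntegers (maximalRealSubfield (fixedField L)))ˣ)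
          (Φ : ↥(formUnitaryGroup (J3 (algebraMap (v.adicCompletionIntegers (maximalRealSubfield (fixedField L)))
            (w.adicCompletion (fixedField L)) (u₀ : v.adicCompletionIntegers (maximalRealSubfield (fixedField L)))))) ≃*
            ↥(formUnitaryGroup (tensorGram (fixedField L) v (gramToy (fixedField L)))))
          (ϖ' : integralClosure (v.adicCompletionIntegers (maximalRealSubfield (fixedField L))) (w.adicCompletion (fixedField L)))
          (hϖ' : Irreducible ϖ')
          (hs' : star (algebraMap (integralClosure (v.adicCompletionIntegers (maximalRealSubfield (fixedField L)))
            (w.adicCompletion (fixedField L))) (w.adicCompletion (fixedField L)) ϖ') =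
              algebraMap (integralClosure (v.adicCompletionIntegers (maximalRealSubfield (fixedField L))) (w.adicCompletion (fixedField L)))
                (w.adicCompletion (fixedField L)) ϖ'),
          (∀ g, g ∈ hyperspecialSubgroup
              (integralClosure (v.adicCompletionIntegers (maximalRealSubfield (fixedField L))) (w.adicCompletion (fixedField L)))
              (J3 (algebraMap (v.adicCompletionIntegers (maximalRealSubfield (fixedField L))) (w.adicCompletion (fixedField L))
                (u₀ : v.adicCompletionIntegers (maximalRealSubfield (fixedField L))))) ↔ Φ g ∈ recordHyperspecial (fixedField L) v l (gramToy (fixedField L))) ∧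
          ∀ {V : Type uV} [AddCommGroup V] [Module k V]
            (ρ : Representation k (↥(formUnitaryGroup (tensorGram (fixedField L) v (gramToy (fixedField L))))) V) [ρ.IsIrreducible],
            KFinite ρ (recordHyperspecial (fixedField L) v l (gramToy (fixedField L))) →
            ∀ [FiniteDimensional k (invariants ρ (recordHyperspecial (fixedField L) v l (gramToy (fixedField L))))],
            invariants ρ (recordHyperspecial (fixedField L) v l (gramToy (fixedField L))) ≠ ⊥ →
            ∃ α : k, α ≠ 0 ∧ Nonempty (ρ.Equiv (comp Φ.symm
              (inertSphericalQuot
                (hstar_of_star_eq (localConj v w hθ.symm (span_pair_eq_top (fixedField L) hy)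
                  (not_isSquare_of_staysPrime (fixedField L) v w hθ hy hmap) (complexConj (fixedField L)))
                  (fun x => by rw [star_p8_eq_star (fixedField L) v w hθ hy (not_isSquare_of_staysPrime (fixedField L) v w hθ hy hmap)]; rfl))
                (algebraMap (v.adicCompletionIntegers (maximalRealSubfield (fixedField L))) (w.adicCompletion (fixedField L))
                  (u₀ : v.adicCompletionIntegers (maximalRealSubfield (fixedField L))))
                (star_algebraMap_of_star_eq (localConj v w hθ.symm (span_pair_eq_top (fixedField L) hy)
                  (not_isSquare_of_staysPrime (fixedField L) v w hθ hy hmap) (complexConj (fixedField L)))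
                  (fun x => by rw [star_p8_eq_star (fixedField L) v w hθ hy (not_isSquare_of_staysPrime (fixedField L) v w hθ hy hmap)]; rfl)
                  (u₀ : v.adicCompletionIntegers (maximalRealSubfield (fixedField L))))
                (algebraMap_unit_ne_zero (F := v.adicCompletion (maximalRealSubfield (fixedField L))) u₀)
                (isInteger_algebraMap (u₀ : v.adicCompletionIntegers (maximalRealSubfield (fixedField L))))
                (isInteger_algebraMap_unit_inv u₀) hϖ' hs' k (α * ((Ideal.absNorm v.asIdeal : k) ^ 2)⁻¹))))) :=
  ((exists_map_eq_iff_mod L p hpm P v).mpr hmod).elim fun w hmap =>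
    ⟨w, hmap, @joint_outside_discriminant_of_staysPrime (fixedField L) _ _ (isCMField_fixedField L) (vRat p) v
      (liesOver_vRat_of_mem p v (natCast_mem_of_liesOver_of_liesOver L p P v))
      (@discr_fixedField_notMem L _ _ _ p _ ((Nat.Prime.coprime_iff_not_dvd hp.out).mp hpm) v
        (liesOver_int_of_mem p v (natCast_mem_of_liesOver_of_liesOver L p P v)))
      w (liesOver_of_map_eq (fixedField L) v w hmap) hmap k _ _ _⟩

end Summit.Ventures.HodgeRepro2.T5RecordJointTwentyOne
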